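import Summits.Ventures.PercRepro.RankLevelSetDepCountHeavyC
import Summits.Ventures.PercRepro.S2SquareMultiplicity

/-!
# PercRepro — THE HEAVY / LIGHT SPLIT OF THE `U`-COUNT, PART C′: THE SQUARE MULTIPLICITY (p8, S3)

`proofs/SUBCLAIM-S3-p8.md` §3g. Part C with p7's SQUARE MULTIPLICITY (`card_pairs_ge_sq`, S2SquareMultiplicity: a
rank-`q` set of `m` elements lies in the fibre of `≥ (m − q)²` pairs) in place of night-1's `m − q`: the light
weights become `σ²(a) = Σ_{j ≤ d − q − 1} C(a, j)/(j + 1)²` (`mul_card_levelLight_le_sum_sq`, `mul_card_levelLight_le_sq`,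
**`ncard_eRk_eq_ncard_le_le_heavy_sq`**). Axioms: standard.
-/

open scoped Matroid

namespace PercRepro

namespace Matroid

open Set Finset

variable {α : Type} {M : _root_.Matroid α}

open scoped Classical in
/-- **The level-`m` double count of the LIGHT sets with the square multiplicity**:
`(m − q)²·#levelLight ≤ Σ_{p ∈ pairsLight} #fibreLevel p m`. -/
theorem mul_card_levelLight_le_sum_sq [M.Finite] (q ν₁ : ℕ) (hq : 1 ≤ q) (hcirc : ∀ C, M.IsCircuit C → 3 ≤ C.encard)
    (m : ℕ) :
    (m - q) ^ 2 * (levelLight M q ν₁ m).card ≤ ∑ p ∈ pairsLight M q ν₁, (fibreLevel M q p m).card := by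
  have hstep1 : ∀ p : Set α × Set α, ((levelLight M q ν₁ m).filter (fun B : Finset α =>
      p.1 ∪ p.2 ⊆ (B : Set α) ∧ (B : Set α) ⊆ M.closure (p.1 ∪ p.2))).card ≤ (fibreLevel M q p m).card := by
    intro p
    unfold fibreLevel levelLight
    exact Finset.card_le_card (Finset.filter_subset_filter
      (fun B : Finset α => p.1 ∪ p.2 ⊆ (B : Set α) ∧ (B : Set α) ⊆ M.closure (p.1 ∪ p.2))
      (Finset.filter_subset (fun B : Finset α => (M.closure (B : Set α)).ncard + 1 ≤ q + ν₁) (levelF M q m)))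
  have hcomm : ∑ p ∈ pairsLight M q ν₁, ((levelLight M q ν₁ m).filter (fun B : Finset α =>
      p.1 ∪ p.2 ⊆ (B : Set α) ∧ (B : Set α) ⊆ M.closure (p.1 ∪ p.2))).card =
      ∑ B ∈ levelLight M q ν₁ m, ((pairsLight M q ν₁).filter (fun p : Set α × Set α =>
        p.1 ∪ p.2 ⊆ (B : Set α) ∧ (B : Set α) ⊆ M.closure (p.1 ∪ p.2))).card := by
    have e1 : ∀ p : Set α × Set α, ((levelLight M q ν₁ m).filter (fun B : Finset α =>
        p.1 ∪ p.2 ⊆ (B : Set α) ∧ (B : Set α) ⊆ M.closure (p.1 ∪ p.2))).card =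
        ∑ B ∈ levelLight M q ν₁ m,
          if p.1 ∪ p.2 ⊆ (B : Set α) ∧ (B : Set α) ⊆ M.closure (p.1 ∪ p.2) then 1 else 0 :=
      fun p => Finset.card_filter _ _
    have e2 : ∀ B : Finset α, ((pairsLight M q ν₁).filter (fun p : Set α × Set α =>
        p.1 ∪ p.2 ⊆ (B : Set α) ∧ (B : Set α) ⊆ M.closure (p.1 ∪ p.2))).card =
        ∑ p ∈ pairsLight M q ν₁,
          if p.1 ∪ p.2 ⊆ (B : Set α) ∧ (B : Set α) ⊆ M.closure (p.1 ∪ p.2) then 1 else 0 :=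
      fun B => Finset.card_filter _ _
    rw [Finset.sum_congr rfl (fun p _ => e1 p), Finset.sum_congr rfl (fun B _ => e2 B)]
    exact Finset.sum_comm
  have hB : ∀ B ∈ levelLight M q ν₁ m, (m - q) ^ 2 ≤ ((pairsLight M q ν₁).filter (fun p : Set α × Set α =>
      p.1 ∪ p.2 ⊆ (B : Set α) ∧ (B : Set α) ⊆ M.closure (p.1 ∪ p.2))).card := by
    intro B hB
    unfold levelLight at hB
    rw [Finset.mem_filter] at hB
    obtain ⟨hBl, hlight⟩ := hB
    obtain ⟨hBg, hBm, hBq⟩ := mem_levelF.1 hBl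
    have hBE : (B : Set α) ⊆ M.E := by rw [← coe_groundF]; exact_mod_cast hBg
    have h := S2.card_pairs_ge_sq q hq hcirc hBE hBq
    rw [hBm] at h
    refine h.trans (Finset.card_le_card ?_)
    intro p hp
    rw [Finset.mem_filter] at hp ⊢
    refine ⟨?_, hp.2⟩
    unfold pairsLight
    rw [Finset.mem_filter]
    refine ⟨hp.1, ?_⟩
    rw [closure_eq_of_reaches hp.2.1 hp.2.2]
    exact hlight
  calc (m - q) ^ 2 * (levelLight M q ν₁ m).card = ∑ _B ∈ levelLight M q ν₁ m, (m - q) ^ 2 := by simp [mul_comm]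
    _ ≤ ∑ B ∈ levelLight M q ν₁ m, ((pairsLight M q ν₁).filter (fun p : Set α × Set α =>
        p.1 ∪ p.2 ⊆ (B : Set α) ∧ (B : Set α) ⊆ M.closure (p.1 ∪ p.2))).card := Finset.sum_le_sum hB
    _ = _ := hcomm.symm
    _ ≤ ∑ p ∈ pairsLight M q ν₁, (fibreLevel M q p m).card := Finset.sum_le_sum (fun p _ => hstep1 p)

open scoped Classical in
/-- **The level-`m` count of the light sets with the square multiplicity.** -/
theorem mul_card_levelLight_le_sq [M.Finite] (q f' ν₁ : ℕ) (hq : 1 ≤ q) (hcirc : ∀ C, M.IsCircuit C → 3 ≤ C.encard)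
    (m : ℕ) :
    (m - q) ^ 2 * (levelLight M q ν₁ m).card ≤
      ((pairsLight M q ν₁).filter (fun p => p ∈ pairsSmall M q f')).card *
          (min (f' - q) (ν₁ - 2)).choose (m - (q + 1)) +
        ((pairsLight M q ν₁).filter (fun p => p ∉ pairsSmall M q f')).card * (ν₁ - 2).choose (m - (q + 1)) := by
  have hsplit : ∑ p ∈ pairsLight M q ν₁, (fibreLevel M q p m).card =
      ∑ p ∈ (pairsLight M q ν₁).filter (fun p => p ∈ pairsSmall M q f'), (fibreLevel M q p m).card +
        ∑ p ∈ (pairsLight M q ν₁).filter (fun p => p ∉ pairsSmall M q f'), (fibreLevel M q p m).card :=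
    (Finset.sum_filter_add_sum_filter_not (pairsLight M q ν₁) _ _).symm
  calc (m - q) ^ 2 * (levelLight M q ν₁ m).card ≤ ∑ p ∈ pairsLight M q ν₁, (fibreLevel M q p m).card :=
        mul_card_levelLight_le_sum_sq q ν₁ hq hcirc m
    _ = _ := hsplit
    _ ≤ ∑ _p ∈ (pairsLight M q ν₁).filter (fun p => p ∈ pairsSmall M q f'),
          (min (f' - q) (ν₁ - 2)).choose (m - (q + 1)) +
          ∑ _p ∈ (pairsLight M q ν₁).filter (fun p => p ∉ pairsSmall M q f'), (ν₁ - 2).choose (m - (q + 1)) :=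
        add_le_add
          (Finset.sum_le_sum (fun p hp => by
            rw [Finset.mem_filter] at hp
            exact card_fibreLevel_light_small q f' ν₁ hp.1 hp.2 m))
          (Finset.sum_le_sum (fun p hp => by
            rw [Finset.mem_filter] at hp
            exact card_fibreLevel_light q ν₁ hp.1 m))
    _ = _ := by rw [Finset.sum_const, smul_eq_mul, Finset.sum_const, smul_eq_mul]

open scoped Classical in
/-- **The `U`-count with the heavy / light split and the SQUARE multiplicity**, in `ℚ`:
`#{B ⊆ E : r(B) = q, |B| ≤ d} ≤ C(n, q) + σ²(min(f′ − q, ν₁ − 2))·#(light small pairs) + σ²(ν₁ − 2)·#(light big pairs)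
  + #{heavy sets}`, `σ²(a) = Σ_{j ≤ d − q − 1} C(a, j)/(j + 1)²`. -/
theorem ncard_eRk_eq_ncard_le_le_heavy_sq (M : _root_.Matroid α) [M.Finite] (q f' ν₁ : ℕ) (hq : 1 ≤ q)
    (hcirc : ∀ C, M.IsCircuit C → 3 ≤ C.encard) (d : ℕ) :
    ({B : Set α | B ⊆ M.E ∧ M.eRk B = q ∧ B.ncard ≤ d}.ncard : ℚ) ≤
      (M.E.ncard.choose q : ℚ) +
        (∑ j ∈ Finset.range (d - (q + 1) + 1), ((min (f' - q) (ν₁ - 2)).choose j : ℚ) / ((j + 1) ^ 2)) *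
          (((pairsLight M q ν₁).filter (fun p => p ∈ pairsSmall M q f')).card : ℚ) +
        (∑ j ∈ Finset.range (d - (q + 1) + 1), ((ν₁ - 2).choose j : ℚ) / ((j + 1) ^ 2)) *
          (((pairsLight M q ν₁).filter (fun p => p ∉ pairsSmall M q f')).card : ℚ) +
        ({B : Set α | B ⊆ M.E ∧ M.eRk B = (q : ℕ∞) ∧ q + ν₁ ≤ (M.closure B).ncard}.ncard : ℚ) := by
  set Ef := groundF M with hEf
  have hE : (Ef : Set α) = M.E := coe_groundF M
  have hEcard : Ef.card = M.E.ncard := card_groundF M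
  set S := {B : Set α | B ⊆ M.E ∧ M.eRk B = q ∧ B.ncard ≤ d} with hS
  set S₁ := {B : Set α | B ⊆ (Ef : Set α) ∧ B.ncard = q} with hS₁
  set S₂ := {B : Set α | B ⊆ M.E ∧ M.eRk B = q ∧ q < B.ncard ∧ B.ncard ≤ d} with hS₂
  set Hv := {B : Set α | B ⊆ M.E ∧ M.eRk B = (q : ℕ∞) ∧ q + ν₁ ≤ (M.closure B).ncard} with hHv
  set Ps := ((pairsLight M q ν₁).filter (fun p => p ∈ pairsSmall M q f')).card with hPs
  set Pb := ((pairsLight M q ν₁).filter (fun p => p ∉ pairsSmall M q f')).card with hPb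
  have hsplit : S ⊆ S₁ ∪ S₂ := by
    intro B hB
    have hBfin : B.Finite := M.ground_finite.subset hB.1
    have hle : q ≤ B.ncard := by
      have := M.eRk_le_encard B
      rw [hB.2.1, ← hBfin.cast_ncard_eq] at this
      exact_mod_cast this
    rcases hle.lt_or_eq with h | h
    · exact Or.inr ⟨hB.1, hB.2.1, h, hB.2.2⟩
    · exact Or.inl ⟨by rw [hE]; exact hB.1, h.symm⟩
  have hS₁fin : S₁.Finite := (Ef.finite_toSet.finite_subsets).subset (fun B hB => hB.1)
  have hS₂fin : S₂.Finite := M.ground_finite.finite_subsets.subset (fun B hB => hB.1)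
  have hS₁ : S₁.ncard = M.E.ncard.choose q := by
    rw [hS₁, ncard_subsets_ncard_eq Ef q, hEcard]
  -- the light levels
  have hlevel : ∀ m ∈ Finset.Icc (q + 1) d, ((levelLight M q ν₁ m).card : ℚ) ≤
      ((Ps : ℚ) * ((min (f' - q) (ν₁ - 2)).choose (m - (q + 1)) : ℚ) +
        (Pb : ℚ) * ((ν₁ - 2).choose (m - (q + 1)) : ℚ)) / (((m - q : ℕ) : ℚ) ^ 2) := by
    intro m hm
    rw [Finset.mem_Icc] at hm
    have hpos : (0 : ℚ) < ((m - q : ℕ) : ℚ) ^ 2 := by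
      have : (0 : ℚ) < ((m - q : ℕ) : ℚ) := by exact_mod_cast (by omega : 0 < m - q)
      positivity
    rw [le_div_iff₀ hpos]
    have h := mul_card_levelLight_le_sq q f' ν₁ hq hcirc m
    have h' : (((m - q) ^ 2 * (levelLight M q ν₁ m).card : ℕ) : ℚ) ≤
        ((Ps * (min (f' - q) (ν₁ - 2)).choose (m - (q + 1)) + Pb * (ν₁ - 2).choose (m - (q + 1)) : ℕ) : ℚ) := by
      exact_mod_cast h
    push_cast at h'
    linarith
  -- the levels
  have hS₂q : (S₂.ncard : ℚ) ≤ ∑ m ∈ Finset.Icc (q + 1) d,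
      ((Ps : ℚ) * ((min (f' - q) (ν₁ - 2)).choose (m - (q + 1)) : ℚ) +
        (Pb : ℚ) * ((ν₁ - 2).choose (m - (q + 1)) : ℚ)) / (((m - q : ℕ) : ℚ) ^ 2) + (Hv.ncard : ℚ) := by
    have h3' : ∑ m ∈ Finset.Icc (q + 1) d, (levelHeavy M q ν₁ m).card ≤ Hv.ncard := by
      rw [hHv]
      exact sum_card_levelHeavy_le q ν₁ d
    have h3q : ((∑ m ∈ Finset.Icc (q + 1) d, (levelHeavy M q ν₁ m).card : ℕ) : ℚ) ≤ (Hv.ncard : ℚ) := by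
      exact_mod_cast h3'
    have h2 : ∑ m ∈ Finset.Icc (q + 1) d, (levelF M q m).card =
        ∑ m ∈ Finset.Icc (q + 1) d, (levelLight M q ν₁ m).card +
          ∑ m ∈ Finset.Icc (q + 1) d, (levelHeavy M q ν₁ m).card := by
      rw [← Finset.sum_add_distrib]
      exact Finset.sum_congr rfl (fun m _ => card_levelF_eq_light_add_heavy q ν₁ m)
    calc (S₂.ncard : ℚ) ≤ ((∑ m ∈ Finset.Icc (q + 1) d, (levelF M q m).card : ℕ) : ℚ) := by
          exact_mod_cast ncard_dep_le_sum_levelF q d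
      _ = ∑ m ∈ Finset.Icc (q + 1) d, ((levelLight M q ν₁ m).card : ℚ) +
            ((∑ m ∈ Finset.Icc (q + 1) d, (levelHeavy M q ν₁ m).card : ℕ) : ℚ) := by
          rw [h2]
          push_cast
          rfl
      _ ≤ _ := add_le_add (Finset.sum_le_sum hlevel) h3q
  -- re-index the level sums
  have hre : ∑ m ∈ Finset.Icc (q + 1) d,
      ((Ps : ℚ) * ((min (f' - q) (ν₁ - 2)).choose (m - (q + 1)) : ℚ) +
        (Pb : ℚ) * ((ν₁ - 2).choose (m - (q + 1)) : ℚ)) / (((m - q : ℕ) : ℚ) ^ 2) =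
      ∑ j ∈ Finset.range (d - q),
        ((Ps : ℚ) * ((min (f' - q) (ν₁ - 2)).choose j : ℚ) / (((j : ℚ) + 1) ^ 2) +
          (Pb : ℚ) * ((ν₁ - 2).choose j : ℚ) / (((j : ℚ) + 1) ^ 2)) := by
    rw [show Finset.Icc (q + 1) d = Finset.image (fun j => q + 1 + j) (Finset.range (d - q)) from ?_]
    · rw [Finset.sum_image (fun a _ b _ h => by omega)]
      apply Finset.sum_congr rfl
      intro j _
      rw [show q + 1 + j - (q + 1) = j by omega, show q + 1 + j - q = j + 1 by omega]
      push_cast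
      ring
    · ext m
      rw [Finset.mem_Icc, Finset.mem_image]
      constructor
      · intro hm
        exact ⟨m - (q + 1), by rw [Finset.mem_range]; omega, by omega⟩
      · rintro ⟨j, hj, rfl⟩
        rw [Finset.mem_range] at hj
        omega
  have hrange : Finset.range (d - q) ⊆ Finset.range (d - (q + 1) + 1) := Finset.range_mono (by omega)
  have hS₂q' : (S₂.ncard : ℚ) ≤
      (∑ j ∈ Finset.range (d - (q + 1) + 1), ((min (f' - q) (ν₁ - 2)).choose j : ℚ) / ((j + 1) ^ 2)) * (Ps : ℚ) +
        (∑ j ∈ Finset.range (d - (q + 1) + 1), ((ν₁ - 2).choose j : ℚ) / ((j + 1) ^ 2)) * (Pb : ℚ) +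
        (Hv.ncard : ℚ) := by
    rw [Finset.sum_mul, Finset.sum_mul]
    refine hS₂q.trans (add_le_add (hre.le.trans ?_) (le_refl _))
    rw [Finset.sum_add_distrib]
    apply add_le_add
    · refine (Finset.sum_le_sum_of_subset_of_nonneg hrange (fun j _ _ => by positivity)).trans' ?_
      apply le_of_eq
      apply Finset.sum_congr rfl
      intro j _
      ring
    · refine (Finset.sum_le_sum_of_subset_of_nonneg hrange (fun j _ _ => by positivity)).trans' ?_
      apply le_of_eq
      apply Finset.sum_congr rfl
      intro j _
      ring
  have hSq : (S.ncard : ℚ) ≤ (S₁.ncard : ℚ) + (S₂.ncard : ℚ) := by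
    have : S.ncard ≤ S₁.ncard + S₂.ncard :=
      (ncard_le_ncard hsplit (hS₁fin.union hS₂fin)).trans (ncard_union_le _ _)
    exact_mod_cast this
  rw [hS₁] at hSq
  linarith

end Matroid

end PercRepro
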